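import Summits.BirchSwinnertonDyer.BirchSwinnertonDyer.Theorems.ManinLocalTwoThreeManinPrimeToThreeAtNineOfKatoFact
import Summits.BirchSwinnertonDyer.Rank1Residual.X12.CMIrreducible
import Literature.NumberTheory.EllipticCurves.ComplexMultiplicationNotSemistable
import Literature.NumberTheory.EllipticCurves.ManinConstantClassCertificateTwist
import Literature.NumberTheory.EllipticCurves.Rank1Residual.Predicates
import HarnessLib

/-!
# Manin at a CM-inert bad `3` from ONE named statement: Kato's `p = 3` polar reading
# (line `bed_at_three`, crux `InertBadAtThree`, stmt-BirchSwinnertonDyer-19225; stub `stub_maninAtThreeQuartic`)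

Crux `InertBadAtThree` (stmt-BirchSwinnertonDyer-19225; routes `InertBadSignedBranches` r4 /
`BiquadraticEisensteinDescent` r5), line `bed_at_three` (ideator bsd-idea-18 g3; skeleton v3
`Cruxes/InertBadAtThree/Lines/bed_at_three.lean` 2c65c7999368d398, lead `bsd-line-ibd-p1` g4/g5). Its registered
stub `stub_maninAtThreeQuartic : ManinAtThreeQuartic` — Manin `3 ∤ c(D)` for a lattice-optimal `X₀(N_W)`-datum `D`
of a globally minimal CM curve `W` of analytic rank one with `3` inert in the CM field and bad at `3`, on the
quartic cell `j = 1728`, Kodaira `III/III*` at `3` — was booked by g4 as «open, small, no source» (Edixhoven 1991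
Thm. 3 reads `p ≥ 11`; Česnavičius 2018 the semistable primes; Česnavičius–Neururer–Saha 2024 only
`v₃(c) ≤ v₃(deg φ)`; Agashe–Ribet–Stein 2006 §2: Edixhoven's small-prime bounds unpublished).

THIS FILE (lead g5, THEOREMS ONLY — no definition, no named fact, no `sorry`): the stub, and in fact the whole
`p = 3` Manin input `ManinAtThree` of the line (v1 stub R₃, all Kodaira cells at once), follows from ONE named
Literature statement already in the tree,

  `Literature.NumberTheory.EllipticCurves.kato_neron_isIntegral_twistedSymbolSum_of_additive_three_polar`

(F-es-18 of cell `pub/bsd-f2-manin`: Kato, Astérisque 295 (2004) (8.1.3) + Thm. 9.7 + Thm. 6.6 (1) read in Néron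
units at the additive prime `3` through Kosters–Pannekoek's §3.3.1 receptacle, for tame characters with
`χ(3) ∉ {±1}`; a DERIVED READING, statement-only, size XL, audited by two refuter seats there), through route
`ManinLocalTwoThree`'s Euler-system lever at `p = 3`:

  `Theorems.ManinLocalTwoThree.katoShiftTwistManinThree_of_katoFact :
     F-es-18 → KatoShiftTwistManinThree`

(`Rank1Residual.ManinAdditive.KatoShiftTwistManinThree`: for every globally minimal `W`, every level `N` with
`9 ∣ N` and every datum with the lattice clause `Λ_W = c·Λ_f`, `W[3]` irreducible ⟹ `3 ∤ c`; its second input,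
the shift-class generation law E-es-19, is the tree THEOREM `shiftClassGenerationThree_holds`). For a CM curve
with `3` inert in the CM field, `W[3]` is irreducible (`X12.irr_of_cmInert`, Mazur 1978 Prop. 6.3 (1)), and a bad
`3` is additive (a CM curve has no multiplicative prime, `not_hasMultiplicativeReductionAtPrime_of_hasCM`,
Silverman ATAEC II.6.4), so `9 ∣ N_W` (`sq_dvd_conductorNorm_of_not_good_of_not_mult`). Hence:

* `not_three_dvd_c_of_katoFactThreePolar_of_cmInert` — per curve and datum;
* `maninAtThree_of_katoFactThreePolar` — the v1 stub statement `ManinAtThree` (body verbatim) from F-es-18 ALONE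
  (no Mazur / Abbes–Ullmo / Česnavičius / modularity input, no Kodaira split);
* `maninAtThreeQuartic_of_katoFactThreePolar` — the registered v3 stub statement `ManinAtThreeQuartic` (body
  verbatim; its quartic hypothesis is not used).

HONEST STATUS: `stub_maninAtThreeQuartic` is DISCHARGED MODULO F-es-18, a named derived reading of printed
theorems that is NOT itself verbatim print (its steps (P1)–(P5) are written out in the Literature file and were
refuter-audited; the same statement is the registered stub `stub_katoFactThreePolar` of route
`ManinLocalTwoThree`'s crux `ManinPrimeToThreeAtNine`, line `kato_shift_three`). The skeleton v4 of
`bed_at_three` therefore replaces the Manin stub by that named-fact stub (shared debt), sorries 3 → 3 with the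
research content of the Manin cell GONE: the line's open stubs are the heart E_K′@3 and two print/held inputs.
19225 is NOT closed; BSD is not proved by any of this.

References: [cite: Kato2004Asterisque, (8.1.3) (p. 180), Thm. 9.7 (p. 189), Thm. 6.6 (1) (p. 163)];
[cite: KostersPannekoek2017, Thm. 1 (ii) and §3.3.1]; [cite: Mazur1978, §6 Prop. 6.3 (1) (p. 153)];
[cite: SilvermanATAEC1994, Thm. II.6.4 and IV.9.4 Table 4.1]; [cite: EdixhovenManin1991, Thm. 3];
[cite: CesnaviciusNeururerSaha2023, Thm. 1.2]; `Theorems/ManinLocalTwoThreeManinPrimeToThreeAtNineOfKatoFact.lean`;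
`Rank1Residual/ManinAdditive/KatoShiftThreeLaws.lean`; `Cruxes/InertBadAtThree/Lines/bed_at_three.lean`.
-/

set_option autoImplicit false
set_option linter.dupNamespace false

noncomputable section

open scoped Classical

open WeierstrassCurve IsDedekindDomain Rat.HeightOneSpectrum
  Literature.NumberTheory.DiophantineGeometry
  Literature.NumberTheory.EllipticCurves Literature.NumberTheory.EllipticCurves.Rank1Residual
  Literature.NumberTheory.EllipticCurves.ModularForms

namespace Summit.BirchSwinnertonDyer.BirchSwinnertonDyer.Theorems.InertBadSignedBranchesInertBadAtThreeManinOfKatoThree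

open Summit.BirchSwinnertonDyer.Rank1Residual
open Summit.BirchSwinnertonDyer.BirchSwinnertonDyer.Theorems.ManinLocalTwoThree (katoShiftTwistManinThree_of_katoFact)

/-! ## §1 Per curve: `3 ∤ c` at a lattice-optimal datum of a CM curve with `3` inert and bad -/

/-- **A bad CM-inert `3` is additive, so `9 ∣ N_W`.** A CM curve has no multiplicative prime (Silverman ATAEC
II.6.4 / proof of II.10.5, tree `not_hasMultiplicativeReductionAtPrime_of_hasCM`), so a bad `3` is additive and
`3² ∣ N` (ATAEC IV.10.2(c), tree `sq_dvd_conductorNorm_of_not_good_of_not_mult`).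
[cite: SilvermanATAEC1994, Thm. II.6.4 (PDF p. 148) and IV.10.2(c)] -/
theorem nine_dvd_conductorNorm_of_hasCM_of_not_good (W : WeierstrassCurve ℚ) [W.IsElliptic]
    (hCM : W.HasCM) (hbad : ¬ Good W 3) : 3 ^ 2 ∣ W.conductorNorm ℤ :=
  haveI : Fact (Nat.Prime 3) := ⟨Nat.prime_three⟩
  sq_dvd_conductorNorm_of_not_good_of_not_mult ⟨hbad, W.not_hasMultiplicativeReductionAtPrime_of_hasCM hCM 3⟩

/-- **`3 ∤ c(D)` for a lattice-optimal conductor-level datum `D` of a globally minimal CM curve with `3` inert in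
the CM field and bad at `3`, GRANTED F-es-18** (`kato_neron_isIntegral_twistedSymbolSum_of_additive_three_polar`):
`W[3]` is irreducible (`X12.irr_of_cmInert`, Mazur 1978 Prop. 6.3 (1)), `9 ∣ N_W` (above), and route
`ManinLocalTwoThree`'s lever `katoShiftTwistManinThree_of_katoFact` applies. CONDITIONAL on the named statement;
nothing is asserted. [cite: Kato2004Asterisque, (8.1.3) (p. 180), Thm. 9.7 (p. 189), Thm. 6.6 (1) (p. 163)]
[cite: Mazur1978, §6 Prop. 6.3 (1) (p. 153)] -/
theorem not_three_dvd_c_of_katoFactThreePolar_of_cmInert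
    (hK : kato_neron_isIntegral_twistedSymbolSum_of_additive_three_polar)
    (W : WeierstrassCurve ℚ) [W.IsElliptic] [W.IsGloballyMinimal] [NeZero (W.conductorNorm ℤ)]
    (D : ModularParametrizationData W (W.conductorNorm ℤ))
    (hopt : ∀ z ∈ D.L.lattice, ∃ w ∈ periodLattice D.f, z = D.c * w)
    (hCM : W.HasCM) (hin : CMInert W 3) (hbad : ¬ Good W 3) : ¬ (3 : ℤ) ∣ D.c :=
  haveI : Fact (Nat.Prime 3) := ⟨Nat.prime_three⟩
  katoShiftTwistManinThree_of_katoFact hK W D hopt (nine_dvd_conductorNorm_of_hasCM_of_not_good W hCM hbad)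
    (X12.irr_of_cmInert W 3 (by norm_num) hin)

/-! ## §2 The line's Manin statements at `3` from F-es-18 alone -/

/-- **Line `bed_at_three`'s v1 stub statement `ManinAtThree` (= BED's R₅₇ `ManinDatumFiveSevenCMInert` with
`p ∈ {5,7} ↦ p = 3`; body VERBATIM) from F-es-18 ALONE** — every Kodaira cell at once (`Iₙ*` and the quartic
`III/III*` cell), with no Mazur / Abbes–Ullmo / Česnavičius / modularity input: per curve by
`not_three_dvd_c_of_katoFactThreePolar_of_cmInert`. CONDITIONAL on the named statement.
[cite: Kato2004Asterisque, (8.1.3) (p. 180), Thm. 9.7 (p. 189), Thm. 6.6 (1) (p. 163)]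
[cite: KostersPannekoek2017, Thm. 1 (ii) and §3.3.1] -/
theorem maninAtThree_of_katoFactThreePolar
    (hK : kato_neron_isIntegral_twistedSymbolSum_of_additive_three_polar) :
    ∀ (W : WeierstrassCurve ℚ) [W.IsElliptic] [W.IsGloballyMinimal] [NeZero (W.conductorNorm ℤ)]
      (p : ℕ) [Fact p.Prime]
      (D : Literature.NumberTheory.EllipticCurves.ModularForms.ModularParametrizationData W
        (W.conductorNorm ℤ)),
      W.HasCM → W.analyticRank = 1 → p = 3 →
      Literature.NumberTheory.EllipticCurves.Rank1Residual.CMInert W p →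
      ¬ Literature.NumberTheory.EllipticCurves.Rank1Residual.Good W p →
      (∀ z ∈ D.L.lattice, ∃ w ∈ Literature.NumberTheory.EllipticCurves.ModularForms.periodLattice D.f,
        z = D.c * w) → ¬ (p : ℤ) ∣ D.c := by
  intro W _ _ _ p _ D hCM _ h3 hin hbad hopt
  subst h3
  exact not_three_dvd_c_of_katoFactThreePolar_of_cmInert hK W D hopt hCM hin hbad

/-- **The registered v3 stub statement `ManinAtThreeQuartic` of line `bed_at_three` (body VERBATIM: the `hRes`
binder of `InertBadSignedBranchesInertBadAtThreeManinCells.maninAtThree_of_facts_of_quarticResidual`) from F-es-18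
ALONE** — the quartic-cell hypothesis (`j = 1728`, Kodaira `III/III*` at the place over `3`) is not needed.
CONDITIONAL on the named statement; `stub_maninAtThreeQuartic` is discharged MODULO F-es-18, not closed.
[cite: Kato2004Asterisque, (8.1.3) (p. 180), Thm. 9.7 (p. 189), Thm. 6.6 (1) (p. 163)]
[cite: KostersPannekoek2017, Thm. 1 (ii) and §3.3.1] -/
theorem maninAtThreeQuartic_of_katoFactThreePolar
    (hK : kato_neron_isIntegral_twistedSymbolSum_of_additive_three_polar) :
    ∀ (W : WeierstrassCurve ℚ) [W.IsElliptic] [W.IsGloballyMinimal] [NeZero (W.conductorNorm ℤ)] (p : ℕ)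
      [Fact p.Prime] (D : Literature.NumberTheory.EllipticCurves.ModularForms.ModularParametrizationData W
        (W.conductorNorm ℤ)) (v : IsDedekindDomain.HeightOneSpectrum ℤ),
      Rat.HeightOneSpectrum.natGenerator v = p → W.HasCM → W.analyticRank = 1 → p = 3 →
      Literature.NumberTheory.EllipticCurves.Rank1Residual.CMInert W p →
      ¬ Literature.NumberTheory.EllipticCurves.Rank1Residual.Good W p →
      (∀ z ∈ D.L.lattice, ∃ w ∈ Literature.NumberTheory.EllipticCurves.ModularForms.periodLattice D.f,
        z = D.c * w) →
      (W.j = 1728 ∧ (W.kodairaSymbolAt v = Literature.NumberTheory.DiophantineGeometry.KodairaSymbol.III ∨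
        W.kodairaSymbolAt v = Literature.NumberTheory.DiophantineGeometry.KodairaSymbol.IIIstar)) →
      ¬ (p : ℤ) ∣ D.c := by
  intro W _ _ _ p _ D v _ hCM hr h3 hin hbad hopt _
  exact maninAtThree_of_katoFactThreePolar hK W p D hCM hr h3 hin hbad hopt

end Summit.BirchSwinnertonDyer.BirchSwinnertonDyer.Theorems.InertBadSignedBranchesInertBadAtThreeManinOfKatoThree

end
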